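import Mathlib
import HarnessLib
import Summits.ValiantsHypothesis.ValiantsHypothesis.Theses.MonotoneRestoration
import Literature.Computability.AlgebraicComplexity.ArithCircuit
import Literature.Computability.AlgebraicComplexity.ArithCircuitProofs
import Literature.Computability.AlgebraicComplexity.MonotoneStructure
import Literature.Computability.AlgebraicComplexity.PermanentIrreducible
import Literature.ModelTheory.FiniteModelTheory.CkEquiv
import Summits.ValiantsHypothesis.ValiantsHypothesis.Theorems.MonotoneRestorationMonotoneRestorationQPCosetCount
import Summits.ValiantsHypothesis.ValiantsHypothesis.Theorems.MonotoneRestorationMonotoneRestorationQPSymmetricLB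
import Summits.ValiantsHypothesis.ValiantsHypothesis.Theorems.MonotoneRestorationMonotoneRestorationQPSupportSymmetrisation
import Summits.ValiantsHypothesis.ValiantsHypothesis.Theorems.MonotoneRestorationMonotoneRestorationQPSparseRegime
import Summits.ValiantsHypothesis.ValiantsHypothesis.Theorems.MonotoneRestorationMonotoneRestorationQPBeta
import Literature.Computability.AlgebraicComplexity.SymmetricArithCircuit
import Literature.Computability.AlgebraicComplexity.DawarWilsenach2025Proofs
import Literature.GroupTheory.PermutationGroups.SmallIndexSubgroups
import Summits.ValiantsHypothesis.ValiantsHypothesis.Theorems.MonotoneRestorationQP.Negative.LoadBearing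
import Summits.ValiantsHypothesis.ValiantsHypothesis.Theorems.MonotoneRestorationMonotoneRestorationQPPermSupportCount

/-! TTRL-lite variant V13505 of stmt-ValiantsHypothesis-15886 -/

-- `Summit.ValiantsHypothesis.ValiantsHypothesis.…` is the tree's mandated single-conjunct layout
-- (Sub = Summit), so the duplicated namespace component is intended.
set_option linter.dupNamespace false

namespace Summit.ValiantsHypothesis.ValiantsHypothesis.Theorems

open Summit.ValiantsHypothesis.ValiantsHypothesis.Theses.MonotoneRestoration
open Literature.Computability.AlgebraicComplexity

/-- **TTRL-lite variant V13505** (`drop_hyp:1`) of the crux `MonotoneRestorationQP`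
(item `stmt-ValiantsHypothesis-15886`) is FALSE: with the polynomial degree / monotone-complexity
hypothesis deleted, the statement claims quasi-polynomial square-symmetric circuits over `ℂ` for
EVERY matrix-symmetric family in `ℝ≥0[x_ij]`; the nonnegative permanent `perPoly (Fin n) ℝ≥0` is
matrix-symmetric and has no such circuits (Dawar–Wilsenach 2025, Thm 7.1, a theorem of the tree).
Immediate from the standing disprover's
`MonotoneRestorationQP.Negative.monotoneRestorationQP_false_without_complexity` (the variant keeping
only the degree bound is already false; dropping the degree bound as well only weakens the
hypotheses further). [cite: DawarWilsenach2025, Thm 7.1] -/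
theorem MonotoneRestorationQP_var13505_false :
    ¬ (∀ f : (n : ℕ) → MvPolynomial (Fin n × Fin n) NNReal,
        (∀ (n : ℕ) (σ τ : Equiv.Perm (Fin n)),
          MvPolynomial.rename (fun p : Fin n × Fin n => (σ p.1, τ p.2)) (f n) = f n) →
        ∃ c : ℕ, ∀ n : ℕ, ∃ (G : Type) (_ : Fintype G)
          (C : Literature.Computability.AlgebraicComplexity.LabelledArithCircuit ℂ
            (Fin n × Fin n) Unit G),
          C.IsSymmetric (Equiv.Perm (Fin n)) ∧
            C.eval (C.output ()) =
              MvPolynomial.map (Complex.ofRealHom.comp NNReal.toRealHom) (f n) ∧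
            Fintype.card G ≤ 2 ^ ((Nat.log 2 n + c) ^ c)) :=
  fun h => MonotoneRestorationQP.Negative.monotoneRestorationQP_false_without_complexity
    (fun f hf _ => h f hf)

end Summit.ValiantsHypothesis.ValiantsHypothesis.Theorems
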